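import Literature.AnabelianGeometry.SemiGraphs.TemperedCompactInVerticialFinite
import Literature.AnabelianGeometry.SemiGraphs.TemperedFixedSystemsOfHstar
import Mathlib.Combinatorics.SimpleGraph.Metric
import HarnessLib

/-!
# [SemiAnbd] Thm. 3.7 (iii): the «no escape» bounds HOLD at every finite graph (non-vacuity)

Mochizuki, *Semi-graphs of anabelioids*, Publ. RIMS **42** (2006), §3, Theorem 3.7 (iii), pp. 40–41
[cite: MochizukiSemiAnbd2006, Thm 3.7(iii) pp.40-41].

PROOF-ONLY non-vacuity certificate (cell abc-iut, layer L3, GAP row G-t6g3-2 / open sub-row G-t6g3-2b;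
seat abc-iut-L3-t10, integrator; no definition).  The closers beyond finite graphs
(`compactInVerticialAt_of_displacement_bounds` / `…_of_noEscape`) take two metric binders at the canonical
level data `verticialLevelData_temperedPiChart h36` of the constructed chart: `hdisp` (every nontrivial
compact `C` has a compatible base system of tree vertices along which its elements have bounded
displacement) and `hbdd` (two compatible `C`-fixed vertex systems stay at bounded subdivision distance).
Here both are PROVED when the underlying semi-graph is FINITE, from the landed finite-graph theory:
`hdisp` with bound `0` along the fixed system of a verticial host of `C`
(`compactInVerticialAt_of_finiteGraph`, abc-iut-L3-t8, + (I1) `fix_temperedPiChart`), and `hbdd` with bound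
`4` — at every level the two vertices are equal or joined by an edge, by the condition (∗_j) of the
compact-form finite-level data (`FiniteLevelDataCpt.hstar` at `finiteLevelDataCptOfTower`) and
abc-iut-w4-d080's `hadj_of_hstar`.  So the two binders of G-t6g3-2b are exactly what print's "since the
semi-graphs `𝔾_j` are all finite" (p. 41) delivers; at infinite countable `𝔾` they are open.

Nothing here takes a side on [IUTchIII] Cor. 3.12.
-/

namespace Literature.AnabelianGeometry.SemiGraphs

open CategoryTheory Topology

universe u

namespace SemiGraph

/-- Two vertices joined by an edge are at subdivision distance `≤ 4` (`v – b – e – b' – v'`).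
[cite: MochizukiSemiAnbd2006, §1 pp.11-12] -/
theorem subdivision_dist_le_four_of_joined {G : SemiGraph.{u}} {v v' : G.Vertex} {e : G.Edge}
    {b b' : G.Branch} (hb : G.edgeOf b = e) (hb' : G.edgeOf b' = e) (hbv : G.abuts b = some v)
    (hb'v : G.abuts b' = some v') :
    G.subdivision.dist (Sum.inl v) (Sum.inl v') ≤ 4 := by
  have a₁ : G.subdivision.Adj (Sum.inl v) (Sum.inr (Sum.inr b)) :=
    (G.subdivision_adj_inl_iff v _).mpr ⟨b, hbv, rfl⟩
  have a₂ : G.subdivision.Adj (Sum.inr (Sum.inr b)) (Sum.inr (Sum.inl e)) :=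
    (G.subdivision_adj_branch_iff b _).mpr (Or.inl (by rw [hb]))
  have a₃ : G.subdivision.Adj (Sum.inr (Sum.inl e)) (Sum.inr (Sum.inr b')) :=
    (G.subdivision_adj_edge_iff e _).mpr ⟨b', hb', rfl⟩
  have a₄ : G.subdivision.Adj (Sum.inr (Sum.inr b')) (Sum.inl v') :=
    (G.subdivision_adj_branch_iff b' _).mpr (Or.inr ⟨v', hb'v, rfl⟩)
  let p : G.subdivision.Walk (Sum.inl v) (Sum.inl v') :=
    SimpleGraph.Walk.cons a₁ (SimpleGraph.Walk.cons a₂ (SimpleGraph.Walk.cons a₃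
      (SimpleGraph.Walk.cons a₄ SimpleGraph.Walk.nil)))
  have h := SimpleGraph.dist_le p
  simpa [p] using h

end SemiGraph

namespace ProfiniteSemiGraph

variable {𝒢 : ProfiniteSemiGraph.{u}}

/-- **`hdisp` holds at every finite graph** (bound `0`): for `𝒢` finite satisfying the hypotheses of
Thm. 3.7, every nontrivial compact `C` of the constructed `π₁^temp(𝒢)` lies in a verticial subgroup
(`compactInVerticialAt_of_finiteGraph`), whose (I1)-fixed compatible vertex system of the canonical trees
is fixed by `C`, hence a base system with displacement `0`. [cite: MochizukiSemiAnbd2006, Thm 3.7(iii) p.41] -/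
theorem hdisp_of_finiteGraph (h37 : 𝒢.Thm37Hypotheses) [Finite 𝒢.graph.Vertex] [Finite 𝒢.graph.Edge] :
    ∀ (C : Subgroup (𝒢.temperedPiChart h37.toProp36Hypotheses).G),
      IsCompact (C : Set (𝒢.temperedPiChart h37.toProp36Hypotheses).G) → C ≠ ⊥ →
      ∃ x : ∀ j, ((verticialLevelData_temperedPiChart (h36 := h37.toProp36Hypotheses)).tree j).Vertex,
        (∀ ⦃i j : ℕ⦄ (hij : i ≤ j),
          ((verticialLevelData_temperedPiChart (h36 := h37.toProp36Hypotheses)).trans hij).vertexMap (x j) =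
            x i) ∧
        ∀ g ∈ C, ∃ N : ℕ, ∀ j,
          ((verticialLevelData_temperedPiChart (h36 := h37.toProp36Hypotheses)).tree j).subdivision.dist
            (Sum.inl (x j))
            (Sum.inl (((verticialLevelData_temperedPiChart (h36 := h37.toProp36Hypotheses)).act j g).hom.vertexMap
              (x j))) ≤ N := by
  intro C hC _
  obtain ⟨⟨v, H, hH, hCH⟩, -⟩ :=
    compactInVerticialAt_of_finiteGraph (𝒢 := 𝒢) h37 (𝒢.temperedPiChart h37.toProp36Hypotheses) C hC
  obtain ⟨x, hxc, hxf⟩ :=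
    (verticialLevelData_temperedPiChart (h36 := h37.toProp36Hypotheses)).fix v H hH
  refine ⟨x, hxc, fun g hg => ⟨0, fun j => ?_⟩⟩
  rw [hxf g (hCH hg) j, SimpleGraph.dist_self]

/-- **`hbdd` holds at every finite graph** (bound `4`): for `𝒢` finite satisfying the hypotheses of
Thm. 3.7 and a nontrivial compact `C`, two compatible `C`-fixed vertex systems of the canonical trees
are, at every level, equal or joined by an edge — the condition (∗_j) of the compact-form finite-level
data of the tower (`FiniteLevelDataCpt.hstar` at `finiteLevelDataCptOfTower`, whose tree-level part IS
`verticialLevelData_temperedPiChart`) and `hadj_of_hstar` — hence at subdivision distance `≤ 4`.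
[cite: MochizukiSemiAnbd2006, Thm 3.7(iii) p.41] -/
theorem hbdd_of_finiteGraph (h37 : 𝒢.Thm37Hypotheses) [Finite 𝒢.graph.Vertex] [Finite 𝒢.graph.Edge] :
    ∀ (C : Subgroup (𝒢.temperedPiChart h37.toProp36Hypotheses).G),
      IsCompact (C : Set (𝒢.temperedPiChart h37.toProp36Hypotheses).G) → C ≠ ⊥ →
      ∀ x x' : ∀ j, ((verticialLevelData_temperedPiChart (h36 := h37.toProp36Hypotheses)).tree j).Vertex,
      (∀ ⦃i j : ℕ⦄ (hij : i ≤ j),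
        ((verticialLevelData_temperedPiChart (h36 := h37.toProp36Hypotheses)).trans hij).vertexMap (x j) =
          x i) →
      (∀ ⦃i j : ℕ⦄ (hij : i ≤ j),
        ((verticialLevelData_temperedPiChart (h36 := h37.toProp36Hypotheses)).trans hij).vertexMap (x' j) =
          x' i) →
      (∀ g ∈ C, ∀ j,
        ((verticialLevelData_temperedPiChart (h36 := h37.toProp36Hypotheses)).act j g).hom.vertexMap (x j) =
          x j) →
      (∀ g ∈ C, ∀ j,
        ((verticialLevelData_temperedPiChart (h36 := h37.toProp36Hypotheses)).act j g).hom.vertexMap (x' j) =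
          x' j) →
      ∃ N : ℕ, ∀ j,
        ((verticialLevelData_temperedPiChart (h36 := h37.toProp36Hypotheses)).tree j).subdivision.dist
          (Sum.inl (x j)) (Sum.inl (x' j)) ≤ N := by
  intro C hC hC1 x x' hx hx' hfx hfx'
  let h36 := h37.toProp36Hypotheses
  -- the compact-form finite-level data of the tower at the constructed chart; its tree part is the
  -- canonical level data (definitionally)
  let Dc : FiniteLevelDataCpt.{0} 𝒢 (𝒢.temperedPiChart h36) :=
    (𝒢.galoisLevelData h36).finiteLevelDataCptOfTower h36.isCountable (𝒢.temperedPiChart h36)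
      (MonoidHom.id _) (𝒢.galoisLevelData_hconn h36) (𝒢.galoisLevelData_isFinite h36) continuous_id
      fix_temperedPiChart stab_temperedPiChart edge_temperedPiChart
      (𝒢.stabBranchPairCpt'_temperedPiChart h36 (galoisLevelData_faithfulV 𝒢 h37))
  have hstar : ∀ C : Subgroup (𝒢.temperedPiChart h36).G, IsCompact (C : Set (𝒢.temperedPiChart h36).G) →
      C ≠ ⊥ → ∀ j : ℕ, ∃ (i : ℕ) (h : j ≤ i),
        ∀ e e' : ((verticialLevelData_temperedPiChart (h36 := h36)).tree i).Edge,
        (∀ γ : C, ((verticialLevelData_temperedPiChart (h36 := h36)).act i γ).hom.edgeMap e = e) →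
        (∀ γ : C, ((verticialLevelData_temperedPiChart (h36 := h36)).act i γ).hom.edgeMap e' = e') →
        ((verticialLevelData_temperedPiChart (h36 := h36)).trans h).edgeMap e =
          ((verticialLevelData_temperedPiChart (h36 := h36)).trans h).edgeMap e' :=
    fun C hC hC1 j => Dc.hstar h37 C hC hC1 j
  refine ⟨4, fun j => ?_⟩
  by_cases hj : x j = x' j
  · rw [hj, SimpleGraph.dist_self]; exact Nat.zero_le _
  · obtain ⟨e, b, b', -, hbe, hb'e, hbx, hb'x, -⟩ :=
      (verticialLevelData_temperedPiChart (h36 := h36)).hadj_of_hstar hstar C hC hC1 x x' hx hx' hfx hfx' j hj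
    exact SemiGraph.subdivision_dist_le_four_of_joined hbe hb'e hbx hb'x

end ProfiniteSemiGraph

end Literature.AnabelianGeometry.SemiGraphs
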